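import Mathlib.NumberTheory.Padics.RingHoms
import Mathlib.RingTheory.PowerSeries.Inverse
import Mathlib.RingTheory.PowerSeries.Order
import Mathlib.RingTheory.Ideal.Quotient.Operations
import HarnessLib

/-!
# LAYER RIGIDITY in `Λ₂ = ℤ_p⟦T₂⟧⟦T₁⟧`: one-sided two-variable DIVISIBILITY up to a power of `p` plus EXACT agreement modulo infinitely many
# «layer relations» `φ_n(T₂)` (e.g. `φ_n = Φ_{pⁿ}(1+T₂)`, the lines `T₂ = ζ_{pⁿ} − 1`) forces EQUALITY of principal ideals

Cell `bsd-print-cf2`, width seat `bsd-line-cf2c-w8` g6 (prover-bsd-line-cf2c-w8-g6-0); memo `Cruxes/MainConjClauseAtSplitTwoQuad/A-BRICK-PRINT-MAP-cf2c-w8g6.md` §5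
(«rigidity road» for M-LINE-PIN's stub (Q)): the two-variable identity `(char X) = (char U/C̄)` (or the class-group half (a)) follows from (i) a
DIVISIBILITY `A ∣ p^k·B` in `Λ₂` (the Euler-system half, any `p`-power slack) and (ii) EXACT agreement `(A) = (B)`, `A` a non-zero-divisor, modulo
`φ_n(T₂)` for infinitely many layer relations `φ_n` (one-variable main conjectures at the finite-order characters of the second variable — at
`p = 2`: Müller 2020 Thm. 1.1 over the layers `K_θ·K^{(v̄)}_n` — read through control). Contrast (memo §2(i)): without (i), (ii) on EVERY layer does
not suffice (`T₂ + 2T₁` vs `T₂ − 2T₁`). Everything here is PURE ALGEBRA over `ℤ_p` (no cyclotomic input: a «layer family» is any sequence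
`φ : ℕ → ℤ_p⟦T⟧` whose reductions mod `p` are non-zero and divisible by arbitrarily high powers of `T` — `Φ_{pⁿ}(1+T) ≡ T^{pⁿ⁻¹(p−1)} (mod p)` qualifies):
* §1 coefficient calculus: `C a ∣ f ↔ ∀ m, a ∣ coeff m f` (`C_dvd_iff_forall_dvd_coeff`), reduction mod `p` of `ℤ_p⟦T⟧` and its kernel;
* §2 **`dvd_of_forall_mem_sup_span` (LEMMA W′)**: `f ∈ (p^k) + (φ_n)` for every member of a layer family ⟹ `p^k ∣ f` (induction on `k`: reduce mod `p`,
  `𝔽_p⟦T⟧` is a domain and `⋂_N (T^N) = 0`);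
* §3 **`span_singleton_eq_of_dvd_of_layers` (THEOREM R′)**: `A·h = p^k·B` in `Λ₂` and, for every `n`, some `u_n` with `A·u_n ≡ B`, `u_n` a unit and `A`
  a non-zero-divisor modulo `(C φ_n)` ⟹ `Ideal.span {A} = Ideal.span {B}` (`h = p^k h′` coefficientwise by §2, `A h′ = B`, and `h′ ≡ u_n` is a unit modulo an
  ideal inside the maximal ideal of the local ring `Λ₂`, hence a unit).
THEOREMS ONLY; Mathlib-only imports; no `def`, no named fact, no `sorry`. No summit statement is proved; BSD is not proved by any of this.
presearch: «two-variable Iwasawa main conjecture from one-variable specialisations plus divisibility» → de Shalit 1987 III §1.10–1.13 (specialisation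
principle, p odd), [Washington1997] §13.2; the rigidity itself — folklore (Weierstrass preparation); nothing to cite as a theorem. beyond-print theorem: no.

References: [Washington1997] §7.1 (Weierstrass preparation), §13.2; [deShalit1987] III §1; [BourbakiAlgComm] VII §3 (power series over a DVR).
-/

set_option autoImplicit false
-- the summit namespace `Summit.BirchSwinnertonDyer.BirchSwinnertonDyer` repeats the problem name by design (D-0017)
set_option linter.dupNamespace false

open PowerSeries

namespace Summit.BirchSwinnertonDyer.BirchSwinnertonDyer.Theorems.PrintCf2.LayerRigidity

/-! ## §1. Coefficient calculus -/

section Coeff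

variable {R : Type*} [CommRing R]

/-- `C a ∣ f` iff `a` divides every coefficient of `f`. [folklore] -/
theorem C_dvd_iff_forall_dvd_coeff (a : R) (f : PowerSeries R) : C a ∣ f ↔ ∀ m : ℕ, a ∣ coeff m f := by
  constructor
  · rintro ⟨g, rfl⟩ m
    exact ⟨coeff m g, by rw [coeff_C_mul]⟩
  · intro h
    choose g hg using h
    refine ⟨PowerSeries.mk g, ?_⟩
    ext m
    rw [coeff_C_mul, coeff_mk, hg m]

/-- Membership in `(C a)` is coefficientwise divisibility. [folklore] -/
theorem mem_span_C_iff (a : R) (f : PowerSeries R) : f ∈ Ideal.span {C a} ↔ ∀ m : ℕ, a ∣ coeff m f := by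
  rw [Ideal.mem_span_singleton, C_dvd_iff_forall_dvd_coeff]

end Coeff

/-! ## §2. LEMMA W′ over `ℤ_p⟦T⟧`: membership in `(p^k) + (φ_n)` along a layer family forces `p^k ∣ f` -/

section OneVariable

variable {p : ℕ} [Fact p.Prime]

/-- Reduction of coefficients modulo `p`: `ℤ_p⟦T⟧ → 𝔽_p⟦T⟧` kills exactly the multiples of `p`. [folklore] -/
theorem map_toZMod_eq_zero_iff (f : PowerSeries ℤ_[p]) :
    PowerSeries.map (PadicInt.toZMod (p := p)) f = 0 ↔ C (p : ℤ_[p]) ∣ f := by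
  rw [C_dvd_iff_forall_dvd_coeff, PowerSeries.ext_iff]
  refine forall_congr' fun m ↦ ?_
  rw [coeff_map, map_zero, ← RingHom.mem_ker, PadicInt.ker_toZMod, PadicInt.maximalIdeal_eq_span_p, Ideal.mem_span_singleton]

/-- `p` is a non-zero-divisor «up to reduction»: `p ∣ f·g` and `p ∤ f` (mod `p` non-zero) ⟹ `p ∣ g` (`𝔽_p⟦T⟧` is a domain). [folklore] -/
theorem C_natCast_dvd_of_mul {f g : PowerSeries ℤ_[p]} (hfg : C (p : ℤ_[p]) ∣ f * g)
    (hf : PowerSeries.map (PadicInt.toZMod (p := p)) f ≠ 0) : C (p : ℤ_[p]) ∣ g := by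
  rw [← map_toZMod_eq_zero_iff] at hfg ⊢
  rw [map_mul] at hfg
  exact (mul_eq_zero.mp hfg).resolve_left hf

/-- Cancelling `p^j` against a mod-`p` non-zero factor: `φ·c = p^j·x`, `φ̄ ≠ 0` ⟹ `φ ∣ x`… in the form needed below: `p^j ∣ c`. [folklore] -/
theorem C_pow_dvd_of_mul_eq {φ c x : PowerSeries ℤ_[p]} (hφ : PowerSeries.map (PadicInt.toZMod (p := p)) φ ≠ 0) :
    ∀ (j : ℕ), φ * c = C ((p : ℤ_[p]) ^ j) * x → C ((p : ℤ_[p]) ^ j) ∣ c := by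
  intro j
  induction j generalizing c x with
  | zero => intro _; exact ⟨c, by rw [pow_zero, map_one, one_mul]⟩
  | succ j ih =>
    intro h
    have hpc : C (p : ℤ_[p]) ∣ c := by
      refine C_natCast_dvd_of_mul ⟨C ((p : ℤ_[p]) ^ j) * x, ?_⟩ hφ
      rw [h, pow_succ, map_mul]; ring
    obtain ⟨c', rfl⟩ := hpc
    have h' : φ * c' = C ((p : ℤ_[p]) ^ j) * x := by
      have hp0 : (C (p : ℤ_[p]) : PowerSeries ℤ_[p]) ≠ 0 := by
        rw [Ne, map_eq_zero_iff _ (C_injective (R := ℤ_[p]))]; exact_mod_cast (Fact.out : p.Prime).ne_zero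
      apply mul_left_cancel₀ hp0
      rw [← mul_assoc, mul_comm (C (p : ℤ_[p])) φ, mul_assoc, h, pow_succ, map_mul]; ring
    obtain ⟨d, rfl⟩ := ih h'
    exact ⟨d, by rw [pow_succ, map_mul]; ring⟩

/-- **LEMMA W′.** `φ : ℕ → ℤ_p⟦T⟧` a LAYER FAMILY (every `φ_n` non-zero mod `p`; for every `N` some `φ_n` is divisible by `T^N` mod `p`) and `f ∈ (p^k) + (φ_n)`
for every `n` ⟹ `p^k ∣ f`. (Reduce mod `p`: `f̄ ∈ ⋂ (φ̄_n) ⊆ ⋂_N (T^N) = 0`, so `f = p f₁`; then `φ_n b_n = p(…)` forces `p ∣ b_n` since `φ̄_n ≠ 0`, so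
`f₁ ∈ (p^{k−1}) + (φ_n)`; induct.) [cite: Washington1997, §7.1 (Weierstrass preparation; the valuation form `v(f(ζ_{pⁿ}−1)) → c`)] -/
theorem dvd_of_forall_mem_sup_span (φ : ℕ → PowerSeries ℤ_[p])
    (hφ₁ : ∀ n, PowerSeries.map (PadicInt.toZMod (p := p)) (φ n) ≠ 0)
    (hφ₂ : ∀ N : ℕ, ∃ n, (X : PowerSeries (ZMod p)) ^ N ∣ PowerSeries.map (PadicInt.toZMod (p := p)) (φ n)) :
    ∀ (k : ℕ) (f : PowerSeries ℤ_[p]), (∀ n, f ∈ Ideal.span {C ((p : ℤ_[p]) ^ k)} ⊔ Ideal.span {φ n}) →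
      C ((p : ℤ_[p]) ^ k) ∣ f := by
  intro k
  induction k with
  | zero => intro f _; exact ⟨f, by rw [pow_zero, map_one, one_mul]⟩
  | succ k ih =>
    intro f hf
    -- `f̄ = 0`
    have hf0 : PowerSeries.map (PadicInt.toZMod (p := p)) f = 0 := by
      ext m
      rw [map_zero]
      obtain ⟨n, hn⟩ := hφ₂ (m + 1)
      obtain ⟨a, ha, b, hb, hab⟩ := Submodule.mem_sup.mp (hf n)
      obtain ⟨a', rfl⟩ := Ideal.mem_span_singleton.mp ha
      obtain ⟨b', rfl⟩ := Ideal.mem_span_singleton.mp hb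
      obtain ⟨q, hq⟩ := hn
      have : PowerSeries.map (PadicInt.toZMod (p := p)) f = X ^ (m + 1) * (q * PowerSeries.map (PadicInt.toZMod (p := p)) b') := by
        rw [← hab, map_add, map_mul, map_mul, hq, map_C, pow_succ, map_mul, map_natCast, ZMod.natCast_self, mul_zero, map_zero,
          zero_mul, zero_add, mul_assoc]
      rw [this, coeff_X_pow_mul', if_neg (by omega)]
    obtain ⟨f₁, rfl⟩ := (map_toZMod_eq_zero_iff f).mp hf0
    -- `f₁ ∈ (p^k) + (φ_n)` for every `n`
    have hf₁ : ∀ n, f₁ ∈ Ideal.span {C ((p : ℤ_[p]) ^ k)} ⊔ Ideal.span {φ n} := by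
      intro n
      obtain ⟨a, ha, b, hb, hab⟩ := Submodule.mem_sup.mp (hf n)
      obtain ⟨a', rfl⟩ := Ideal.mem_span_singleton.mp ha
      obtain ⟨b', rfl⟩ := Ideal.mem_span_singleton.mp hb
      -- `φ_n b' = p (f₁ − p^k a')` ⟹ `p ∣ b'`
      have hb' : C (p : ℤ_[p]) ∣ b' := by
        refine C_natCast_dvd_of_mul ⟨f₁ - C ((p : ℤ_[p]) ^ k) * a', ?_⟩ (hφ₁ n)
        rw [mul_sub, ← hab, pow_succ, map_mul]; ring
      obtain ⟨b'', rfl⟩ := hb'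
      have hp0 : (C (p : ℤ_[p]) : PowerSeries ℤ_[p]) ≠ 0 := by
        rw [Ne, map_eq_zero_iff _ (C_injective (R := ℤ_[p]))]; exact_mod_cast (Fact.out : p.Prime).ne_zero
      have hf₁eq : f₁ = C ((p : ℤ_[p]) ^ k) * a' + φ n * b'' := by
        apply mul_left_cancel₀ hp0
        rw [← hab, pow_succ, map_mul]; ring
      rw [hf₁eq]
      exact Submodule.add_mem_sup (Ideal.mem_span_singleton.mpr (dvd_mul_right _ _)) (Ideal.mem_span_singleton.mpr (dvd_mul_right _ _))
    obtain ⟨g, rfl⟩ := ih f₁ hf₁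
    exact ⟨g, by rw [pow_succ, map_mul]; ring⟩

end OneVariable

/-! ## §3. THEOREM R′ in `Λ₂ = ℤ_p⟦T₂⟧⟦T₁⟧`: divisibility + the layers ⟹ equality of principal ideals -/

section TwoVariable

variable {p : ℕ} [Fact p.Prime]

/-- A unit modulo an ideal contained in the maximal ideal of a local ring is a unit. [folklore] -/
theorem isUnit_of_isUnit_mk {S : Type*} [CommRing S] [IsLocalRing S] {I : Ideal S} (hI : I ≤ IsLocalRing.maximalIdeal S) {x : S}
    (hx : IsUnit (Ideal.Quotient.mk I x)) : IsUnit x := by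
  obtain ⟨y, hy⟩ := hx.exists_right_inv
  obtain ⟨y, rfl⟩ := Ideal.Quotient.mk_surjective y
  rw [← map_mul, ← map_one (Ideal.Quotient.mk I), Ideal.Quotient.eq] at hy
  have hxy : IsUnit (x * y) := by
    by_contra h
    exact (IsLocalRing.maximalIdeal.isMaximal S).ne_top
      (Ideal.eq_top_of_isUnit_mem _ (sub_sub_cancel (x * y) 1 ▸ Ideal.sub_mem _ ((IsLocalRing.mem_maximalIdeal _).mpr h) (hI hy) :
        (1 : S) ∈ IsLocalRing.maximalIdeal S) isUnit_one)
  exact isUnit_of_mul_isUnit_left hxy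

/-- A layer relation `φ` (divisible by `T` mod `p`) is a NON-unit of `ℤ_p⟦T⟧`, so `(C φ)` lies in the maximal ideal of the local ring `Λ₂`. [folklore] -/
theorem span_C_le_maximalIdeal {φ : PowerSeries ℤ_[p]} (hφ : (X : PowerSeries (ZMod p)) ∣ PowerSeries.map (PadicInt.toZMod (p := p)) φ) :
    Ideal.span {(C φ : PowerSeries (PowerSeries ℤ_[p]))} ≤ IsLocalRing.maximalIdeal (PowerSeries (PowerSeries ℤ_[p])) := by
  rw [Ideal.span_le, Set.singleton_subset_iff, SetLike.mem_coe, IsLocalRing.mem_maximalIdeal, mem_nonunits_iff]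
  intro hu
  have h1 : IsUnit φ := by
    have := isUnit_constantCoeff _ hu
    rwa [constantCoeff_C] at this
  have h2 : IsUnit (PadicInt.toZMod (p := p) (constantCoeff φ)) := (isUnit_constantCoeff _ h1).map _
  have h3 : coeff 0 (PowerSeries.map (PadicInt.toZMod (p := p)) φ) = 0 := by
    obtain ⟨q, hq⟩ := hφ
    rw [hq, coeff_zero_X_mul]
  rw [coeff_map, coeff_zero_eq_constantCoeff] at h3
  rw [h3] at h2
  exact not_isUnit_zero h2

/-- **THEOREM R′ (layer rigidity).** In `Λ₂ = ℤ_p⟦T₂⟧⟦T₁⟧` (inner variable `T₂`, relations `C φ_n`): if `A·h = p^k·B` (one-sided divisibility up to a power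
of `p`) and, for every member `φ_n` of a layer family, there is `u_n` with `A·u_n ≡ B (mod C φ_n)`, `u_n` a unit mod `C φ_n`, and `A` a non-zero-divisor
mod `C φ_n` — i.e. `(A) = (B) ≠ 0` on the layer `Λ₂/(C φ_n) = (ℤ_p⟦T₂⟧/φ_n)⟦T₁⟧` —, then **`(A) = (B)` in `Λ₂`**. (`h ≡ p^k u_n`, so each `T₁`-coefficient of `h`
lies in `(p^k) + (φ_n)` for all `n`; LEMMA W′ gives `h = p^k h′`; `A h′ = B`; and `h′ ≡ u_n` is a unit modulo an ideal inside the maximal ideal.)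
[cite: Washington1997, §13.2 (shape); §7.1] [cite: deShalit1987, III §1.10–1.13 (specialisation to the layers)] -/
theorem span_singleton_eq_of_dvd_of_layers (φ : ℕ → PowerSeries ℤ_[p])
    (hφ₁ : ∀ n, PowerSeries.map (PadicInt.toZMod (p := p)) (φ n) ≠ 0)
    (hφ₂ : ∀ N : ℕ, ∃ n, (X : PowerSeries (ZMod p)) ^ N ∣ PowerSeries.map (PadicInt.toZMod (p := p)) (φ n))
    {A B h : PowerSeries (PowerSeries ℤ_[p])} {k : ℕ} (hAB : A * h = C (C ((p : ℤ_[p]) ^ k)) * B)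
    (hline : ∀ n, ∃ u : PowerSeries (PowerSeries ℤ_[p]),
      A * u - B ∈ Ideal.span {C (φ n)} ∧ IsUnit (Ideal.Quotient.mk (Ideal.span {C (φ n)}) u) ∧
      ∀ x, A * x ∈ Ideal.span {C (φ n)} → x ∈ Ideal.span {C (φ n)}) :
    Ideal.span {A} = Ideal.span {B} := by
  set P : PowerSeries ℤ_[p] := C ((p : ℤ_[p]) ^ k) with hP
  have hP0 : P ≠ 0 := by
    rw [hP, Ne, map_eq_zero_iff _ (C_injective (R := ℤ_[p]))]
    exact pow_ne_zero _ (by exact_mod_cast (Fact.out : p.Prime).ne_zero)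
  have hCP0 : (C P : PowerSeries (PowerSeries ℤ_[p])) ≠ 0 := by
    rwa [Ne, map_eq_zero_iff _ (C_injective (R := PowerSeries ℤ_[p]))]
  -- step 1: `h − P u_n ∈ (C φ_n)` for every `n`
  have step1 : ∀ n, ∃ u : PowerSeries (PowerSeries ℤ_[p]), h - C P * u ∈ Ideal.span {C (φ n)} ∧
      IsUnit (Ideal.Quotient.mk (Ideal.span {C (φ n)}) u) := by
    intro n
    obtain ⟨u, hu, hunit, hnzd⟩ := hline n
    refine ⟨u, hnzd _ ?_, hunit⟩
    have : A * (h - C P * u) = -(C P * (A * u - B)) := by rw [mul_sub, hAB]; ring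
    rw [this]
    exact neg_mem (Ideal.mul_mem_left _ _ hu)
  -- step 2: every `T₁`-coefficient of `h` lies in `(p^k) + (φ_n)`, hence is divisible by `p^k`
  have step2 : C P ∣ h := by
    rw [C_dvd_iff_forall_dvd_coeff]
    intro m
    refine dvd_of_forall_mem_sup_span φ hφ₁ hφ₂ k (coeff m h) fun n ↦ ?_
    obtain ⟨u, hu, -⟩ := step1 n
    rw [mem_span_C_iff] at hu
    obtain ⟨c, hc⟩ := hu m
    rw [map_sub, coeff_C_mul] at hc
    have : coeff m h = P * coeff m u + φ n * c := by rw [← hc]; ring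
    rw [this]
    exact Submodule.add_mem_sup (Ideal.mem_span_singleton.mpr (dvd_mul_right _ _)) (Ideal.mem_span_singleton.mpr (dvd_mul_right _ _))
  obtain ⟨h', rfl⟩ := step2
  -- step 3: `A h′ = B`
  have hAB' : A * h' = B := by
    apply mul_left_cancel₀ hCP0
    rw [← hAB]; ring
  -- step 4: `h′` is a unit (choose a layer `φ_n` divisible by `T` mod `p`)
  obtain ⟨n, hn⟩ := hφ₂ 1
  rw [pow_one] at hn
  obtain ⟨u, hu, hunit⟩ := step1 n
  have hsub : h' - u ∈ Ideal.span {C (φ n)} := by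
    -- `P (h′ − u) ∈ (C φ_n)` and `P = p^k` cancels against the mod-`p` non-zero `φ_n`
    rw [mem_span_C_iff] at hu ⊢
    intro m
    obtain ⟨c, hc⟩ := hu m
    rw [← mul_sub, coeff_C_mul] at hc
    -- `φ_n c = p^k (coeff m (h′ − u))`
    obtain ⟨c', rfl⟩ := C_pow_dvd_of_mul_eq (hφ₁ n) k hc.symm
    refine ⟨c', mul_left_cancel₀ hP0 ?_⟩
    rw [hc]; ring
  have hunit' : IsUnit (Ideal.Quotient.mk (Ideal.span {C (φ n)}) h') := by
    have : Ideal.Quotient.mk (Ideal.span {C (φ n)}) h' = Ideal.Quotient.mk (Ideal.span {C (φ n)}) u :=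
      (Ideal.Quotient.eq).mpr hsub
    rw [this]; exact hunit
  have hh' : IsUnit h' := isUnit_of_isUnit_mk (span_C_le_maximalIdeal hn) hunit'
  -- step 5
  rw [← hAB', Ideal.span_singleton_mul_right_unit hh']

/-- **THEOREM R′, char-ideal form of the layer hypothesis** (the form the rigidity road's consumers produce: at layer `n`, GENERIC SPECIALISATION +
CONTROL + Müller give an EQUALITY OF PRINCIPAL IDEALS `(Ā) = (B̄)` in `Λ₂/(C φ_n)` with `Ā` a non-zero-divisor — e.g. `Ā ≠ 0` in the domain
`ℤ_p[ζ_{pⁿ}]⟦T₁⟧`): then `(A) = (B)` in `Λ₂`. (`B̄ = Ā x̄`, `Ā = B̄ ȳ` ⟹ `Ā (1 − x̄ ȳ) = 0` ⟹ `x̄` is a unit.)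
[cite: Washington1997, §13.2 (shape); §7.1] -/
theorem span_singleton_eq_of_dvd_of_layers_of_span_eq (φ : ℕ → PowerSeries ℤ_[p])
    (hφ₁ : ∀ n, PowerSeries.map (PadicInt.toZMod (p := p)) (φ n) ≠ 0)
    (hφ₂ : ∀ N : ℕ, ∃ n, (X : PowerSeries (ZMod p)) ^ N ∣ PowerSeries.map (PadicInt.toZMod (p := p)) (φ n))
    {A B h : PowerSeries (PowerSeries ℤ_[p])} {k : ℕ} (hAB : A * h = C (C ((p : ℤ_[p]) ^ k)) * B)
    (hline : ∀ n,
      Ideal.span {Ideal.Quotient.mk (Ideal.span {C (φ n)}) A} = Ideal.span {Ideal.Quotient.mk (Ideal.span {C (φ n)}) B} ∧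
      ∀ x, A * x ∈ Ideal.span {C (φ n)} → x ∈ Ideal.span {C (φ n)}) :
    Ideal.span {A} = Ideal.span {B} := by
  refine span_singleton_eq_of_dvd_of_layers φ hφ₁ hφ₂ hAB fun n ↦ ?_
  obtain ⟨hspan, hnzd⟩ := hline n
  set I : Ideal (PowerSeries (PowerSeries ℤ_[p])) := Ideal.span {C (φ n)} with hI
  -- `B̄ = Ā x̄` and `Ā = B̄ ȳ`
  have hB : Ideal.Quotient.mk I B ∈ Ideal.span {Ideal.Quotient.mk I A} := by rw [hspan]; exact Ideal.mem_span_singleton_self _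
  have hA : Ideal.Quotient.mk I A ∈ Ideal.span {Ideal.Quotient.mk I B} := by rw [← hspan]; exact Ideal.mem_span_singleton_self _
  obtain ⟨x, hx⟩ := Ideal.mem_span_singleton'.mp hB
  obtain ⟨y, hy⟩ := Ideal.mem_span_singleton'.mp hA
  obtain ⟨x, rfl⟩ := Ideal.Quotient.mk_surjective x
  obtain ⟨y, rfl⟩ := Ideal.Quotient.mk_surjective y
  refine ⟨x, ?_, ?_, hnzd⟩
  · -- `A x − B ∈ I`
    rw [← Ideal.Quotient.eq, map_mul, mul_comm, hx]
  · -- `x̄ ȳ = 1` because `Ā` is a non-zero-divisor mod `I`: `A (x y − 1) ∈ I`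
    have hmem : A * (x * y - 1) ∈ I := by
      rw [← Ideal.Quotient.eq_zero_iff_mem, map_mul, map_sub, map_one, map_mul]
      have : Ideal.Quotient.mk I A * (Ideal.Quotient.mk I x * Ideal.Quotient.mk I y) =
          Ideal.Quotient.mk I y * (Ideal.Quotient.mk I x * Ideal.Quotient.mk I A) := by ring
      rw [mul_sub, mul_one, this, hx, hy, sub_self]
    have h1 : Ideal.Quotient.mk I (x * y) = 1 := by
      have := (Ideal.Quotient.eq (I := I)).mpr (hnzd _ hmem)
      rwa [map_one] at this
    rw [map_mul] at h1
    exact IsUnit.of_mul_eq_one _ h1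

end TwoVariable

end Summit.BirchSwinnertonDyer.BirchSwinnertonDyer.Theorems.PrintCf2.LayerRigidity
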